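import Mathlib
import Summits.ValiantsHypothesis.ValiantsHypothesis.Theorems.BinomialElusiveBinomialCandidatePolarImmersiveAtInfinity
import Summits.ValiantsHypothesis.ValiantsHypothesis.Theorems.BinomialElusiveBinomialCandidateInfinityStepTwo
import Summits.ValiantsHypothesis.ValiantsHypothesis.Theorems.BinomialElusiveBinomialCandidateInfinityStepTwoImproper

/-!
# Crux `BinomialElusive.BinomialCandidate` (stmt-ValiantsHypothesis-7392), line `registered`,
# skeleton v4 — stub `stub_polarStepTwo`: the second peeling step at a pole over `x = 0`

The registered stub `stub_polarStepTwo` of the crux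
`Summit.ValiantsHypothesis.ValiantsHypothesis.Theses.BinomialElusive.BinomialCandidate`.
Data: a quadratic `Γ : ℂ^s → ℂ^m` (`totalDegree (Γ i) ≤ 2`), `N ≥ 1`, a formal Laurent solution
`p` of `Γ_i(p) = t^{N a_i} + t^{N b_i}` (targets WITHOUT coefficients at negative exponents) with
least order `μ < 0`, pole direction `z = (p_j.coeff μ)_j ≠ 0`, and `B_i(z) = 0` for all `i`
(`B_i = homogeneousComponent 2 (Γ i)`, `L_i = homogeneousComponent 1 (Γ i)`).  Claim (dichotomy):
EITHER there is a second direction `z' ∉ ℂ z` with `Σ_j z'_j ∂_jB_i(z) = 0` for ALL `i`, OR there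
is a point `w` with `Σ_j z_j (∂_jΓ_i)(w) = 0` for all `i`.

Proof (lowest-order calculus in the chart of the pole, exactly as in the sibling stubs
`stub_infinityStepTwo` / `stub_infinityStepTwoImproper` at the place over `∞`).  Pick `j₀` with
`z_{j₀} ≠ 0`, normalise `Λ = z_{j₀}⁻¹ p_{j₀}` (no coefficients below `μ`, coefficient `1` at `μ`)
and put `q j = Λ⁻¹ p j`: `p j = Λ q j`, `q j` has no pole, `(q j)(0) = z j`, `q j₀ = z j₀` is
constant, `w j = q j - z j` has positive order.  Let `o ≥ 1` be the least exponent that carries a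
nonzero coefficient of some `w j` or equals `-μ`, and `v j = (w j).coeff o` (so `v j₀ = 0`, and
`v ≠ 0` if `o < -μ`).  Each `q j` is the jet `z j + v j t^o` (`PolarStepTwo.exists_chart`), and
`Γ_i(p) = K_i + Λ L_i(q) + Λ² B_i(q)` has no coefficients below `2μ + o ≤ μ < 0`
(`InfinityStepTwo.coeff_aeval_of_jet`), while the target `t^{N a_i} + t^{N b_i}` has no
coefficients at negative exponents at all (`PolarPeeling.coeff_binomial_eq_zero_of_neg`).

* `o < -μ` (the remainder `Λ w` has a pole): the coefficient of `Γ_i(p)` at `2μ + o < 0` is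
  `Σ_j v_j ∂_jB_i(z)`, hence `0` for every `i`; and `v ≠ 0`, `v j₀ = 0 ≠ z j₀` give `v ∉ ℂ z`.
  First disjunct with `z' = v`.
* `o = -μ` (the remainder is integral, with value `v`): the coefficient of `Γ_i(p)` at `μ < 0` is
  `L_i(z) + Σ_j v_j ∂_jB_i(z)` (`InfinityStepTwoImproper.coeff_aeval_of_jet_top`), hence `0`; and
  `L_i(z) + Σ_j v_j ∂_jB_i(z) = Σ_j z_j (∂_jΓ_i)(v)` by Euler's identity for the linear part and
  the symmetry of the polarisation of the quadratic part
  (`InfinityStepTwoImproper.sum_mul_eval_pderiv_eq`).  Second disjunct with `w = v`.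

Mathlib only, plus the tree files imported above (`PolarPeeling.*`, `PolarImmersive.*`,
`InfinityStepTwo.coeff_aeval_of_jet`, `InfinityStepTwoImproper.*`).
-/

-- layout Summits/ValiantsHypothesis/ValiantsHypothesis forces the duplicated namespace component
set_option linter.dupNamespace false

namespace Summit.ValiantsHypothesis.ValiantsHypothesis.Theorems.BinomialCandidateStubs

open scoped BigOperators

namespace PolarStepTwo

/-- **The chart of a pole and its first jet.**  Let no `p j` have coefficients below `μ < 0`,
write `z j = (p j).coeff μ`, and let `z j₀ ≠ 0`.  Then there are `Λ` (namely `z_{j₀}⁻¹ p_{j₀}`: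
no coefficients below `μ`, coefficient `1` at `μ`), integral series `q j` with `p j = Λ q j`, an
exponent `0 < o ≤ -μ` and a vector `v` with `v j₀ = 0` such that every `q j` is the jet
`z j + v j t^o` up to order `o`, and `v ≠ 0` unless `o = -μ` (`o` is the least exponent carrying
a nonzero coefficient of some `q j - z j`, capped at `-μ`). -/
theorem exists_chart {s : ℕ} (p : Fin s → LaurentSeries ℂ) {μ : ℤ} (hμ : μ < 0)
    (hp : ∀ j, ∀ g < μ, (p j).coeff g = 0) (z : Fin s → ℂ) (hz : ∀ j, (p j).coeff μ = z j)
    {j₀ : Fin s} (hj₀ : z j₀ ≠ 0) :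
    ∃ (Λ : LaurentSeries ℂ) (q : Fin s → LaurentSeries ℂ) (o : ℤ) (v : Fin s → ℂ),
      (∀ g < μ, Λ.coeff g = 0) ∧ Λ.coeff μ = 1 ∧ (p = fun j => Λ * q j) ∧ 0 < o ∧ o ≤ -μ ∧
      (∀ j, ∀ g ≤ o, (q j).coeff g = (if g = 0 then z j else 0) + if g = o then v j else 0) ∧
      v j₀ = 0 ∧ (o < -μ → v ≠ 0) := by
  -- adapted from the sibling stub `stub_infinityStepTwo` (chart at infinity)
  classical
  -- `Λ = z_{j₀}⁻¹ p_{j₀}`: no coefficients below `μ`, coefficient `1` at `μ`, order `μ`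
  set Λ : LaurentSeries ℂ := (z j₀)⁻¹ • p j₀ with hΛdef
  have hΛcoeff : ∀ g, Λ.coeff g = (z j₀)⁻¹ * (p j₀).coeff g := fun g => by
    rw [hΛdef, HahnSeries.coeff_smul, smul_eq_mul]
  have hΛvan : ∀ g < μ, Λ.coeff g = 0 := fun g hg => by
    rw [hΛcoeff, hp j₀ g hg, mul_zero]
  have hΛμ : Λ.coeff μ = 1 := by
    rw [hΛcoeff, hz j₀]
    exact inv_mul_cancel₀ hj₀
  have hΛne : Λ ≠ 0 := by
    intro h
    have h1 := hΛμ
    rw [h, HahnSeries.coeff_zero] at h1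
    exact zero_ne_one h1
  have hΛord : Λ.order = μ := by
    refine le_antisymm (HahnSeries.order_le_of_coeff_ne_zero (by rw [hΛμ]; exact one_ne_zero)) ?_
    by_contra h
    exact (HahnSeries.coeff_order_eq_zero.not.mpr hΛne) (hΛvan _ (not_le.mp h))
  -- `Λ⁻¹`: no coefficients below `-μ`, coefficient `1` at `-μ`
  have hw₀Λ : Λ⁻¹ * Λ = 1 := inv_mul_cancel₀ hΛne
  have hw₀ord : Λ⁻¹.order = -μ := by
    have h := HahnSeries.order_mul (inv_ne_zero hΛne) hΛne
    rw [hw₀Λ, HahnSeries.order_one, hΛord] at h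
    omega
  have hw₀van : ∀ g < -μ, Λ⁻¹.coeff g = 0 := fun g hg =>
    HahnSeries.coeff_eq_zero_of_lt_order (by rwa [hw₀ord])
  have hw₀lead : Λ⁻¹.coeff (-μ) = 1 := by
    have h := PolarPeeling.coeff_mul_eq hw₀van hΛvan
    rw [hw₀Λ, neg_add_cancel, HahnSeries.coeff_one, if_pos rfl, hΛμ, mul_one] at h
    exact h.symm
  -- the chart: `q j = Λ⁻¹ p j`, `p j = Λ q j`, `(q j)(0) = z j`, `q j₀ = z j₀`
  set q : Fin s → LaurentSeries ℂ := fun j => Λ⁻¹ * p j with hqdef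
  have hpq : p = fun j => Λ * q j := by
    funext j
    simp only [hqdef]
    rw [← mul_assoc, mul_inv_cancel₀ hΛne, one_mul]
  have hqvan : ∀ j, ∀ g < 0, (q j).coeff g = 0 := fun j g hg =>
    PolarPeeling.coeff_mul_eq_zero_of_lt hw₀van (hp j) g (by omega)
  have hq0 : ∀ j, (q j).coeff 0 = z j := fun j => by
    have h := PolarPeeling.coeff_mul_eq hw₀van (hp j)
    rw [neg_add_cancel, hw₀lead, one_mul, hz j] at h
    exact h
  have hqj₀ : q j₀ = HahnSeries.C (z j₀) := by
    have h1 : p j₀ = HahnSeries.C (z j₀) * Λ := by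
      rw [HahnSeries.C_mul_eq_smul, hΛdef, smul_inv_smul₀ hj₀]
    show Λ⁻¹ * p j₀ = _
    rw [h1, mul_left_comm, hw₀Λ, mul_one]
  -- the local coordinates `w j = q j - z j` of positive order, `w j₀ = 0`
  set w : Fin s → LaurentSeries ℂ := fun j => q j - HahnSeries.C (z j) with hwdef
  have hwvan : ∀ j, ∀ g < 1, (w j).coeff g = 0 := by
    intro j g hg
    simp only [hwdef, HahnSeries.coeff_sub, HahnSeries.C_apply, HahnSeries.coeff_single]
    rcases lt_or_eq_of_le (show g ≤ 0 by omega) with hg | rfl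
    · rw [hqvan j g hg, if_neg hg.ne, sub_zero]
    · rw [if_pos rfl, hq0, sub_self]
  have hw₀ : w j₀ = 0 := by
    simp only [hwdef, hqj₀, sub_self]
  -- `o ≥ 1`: the least exponent carrying a nonzero coefficient of some `w j`, capped at `-μ`
  obtain ⟨o, hoP, homin⟩ := Int.exists_least_of_bdd
    (P := fun g => (∃ j, (w j).coeff g ≠ 0) ∨ g = -μ)
    ⟨1, fun g hg => by
      by_contra h
      rcases hg with ⟨j, hj⟩ | hg
      · exact hj (hwvan j g (by omega))
      · omega⟩
    ⟨-μ, Or.inr rfl⟩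
  have ho : 0 < o := by
    by_contra h
    rcases hoP with ⟨j, hj⟩ | hg
    · exact hj (hwvan j o (by omega))
    · omega
  have hoμ : o ≤ -μ := homin _ (Or.inr rfl)
  have hbelow : ∀ j, ∀ g < o, (w j).coeff g = 0 := fun j g hg => by
    by_contra h
    exact absurd (homin g (Or.inl ⟨j, h⟩)) (not_le.mpr hg)
  -- the jets `q j = z j + v j t^o`, `v j = (w j).coeff o`
  have hjq : ∀ j, ∀ g ≤ o, (q j).coeff g =
      (if g = 0 then z j else 0) + if g = o then (w j).coeff o else 0 := fun j => by
    refine PolarImmersive.jet_congr (PolarImmersive.jet_add (PolarImmersive.jet_C o (z j))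
      (PolarImmersive.jet_of_coeff_eq_zero (hbelow j))) ?_ (add_zero _) (zero_add _)
    simp only [hwdef]
    ring
  refine ⟨Λ, q, o, fun j => (w j).coeff o, hΛvan, hΛμ, hpq, ho, hoμ, hjq, ?_, fun hlt hv => ?_⟩
  · show (w j₀).coeff o = 0
    rw [hw₀, HahnSeries.coeff_zero]
  · rcases hoP with ⟨j, hj⟩ | hg
    · exact hj (by simpa using congr_fun hv j)
    · exact absurd hg hlt.ne

end PolarStepTwo

open PolarStepTwo in
/-- **Stub `stub_polarStepTwo`** (crux stmt-ValiantsHypothesis-7392, line `registered`, skeleton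
v4): the second peeling step at a pole over `x = 0`.  Given a formal Laurent solution `p` of
`Γ_i(p) = t^{N a_i} + t^{N b_i}` (`Γ` quadratic, `N ≥ 1`) with least order `μ < 0`, pole
direction `z = (p_j.coeff μ)_j ≠ 0` and `B_i(z) = 0` for all `i`
(`B_i = homogeneousComponent 2 (Γ i)`): either there is a second direction `z' ∉ ℂ z` with
`Σ_j z'_j ∂_jB_i(z) = 0` for all `i` (an isotropic `2`-flag for all the quadratic parts), or
there is a point `w` with `Σ_j z_j (∂_jΓ_i)(w) = 0` for all `i` (`dΓ(w) · z = 0`). -/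
theorem stub_polarStepTwo :
    ∀ (m s : ℕ) (a b : Fin m → ℕ) (Γ : Fin m → MvPolynomial (Fin s) ℂ) (N : ℕ) (p : Fin s → LaurentSeries ℂ)
      (μ : ℤ), (∀ i, (Γ i).totalDegree ≤ 2) → 0 < N →
      (∀ i, MvPolynomial.aeval p (Γ i) =
        HahnSeries.single ((N * a i : ℕ) : ℤ) (1 : ℂ) + HahnSeries.single ((N * b i : ℕ) : ℤ) (1 : ℂ)) →
      μ < 0 → (∀ j, ∀ g < μ, (p j).coeff g = 0) → (fun j => (p j).coeff μ) ≠ 0 →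
      (∀ i, MvPolynomial.eval (fun j => (p j).coeff μ) (MvPolynomial.homogeneousComponent 2 (Γ i)) = 0) →
      (∃ z' : Fin s → ℂ, (∀ c : ℂ, z' ≠ c • (fun j => (p j).coeff μ)) ∧ ∀ i,
          ∑ j, z' j * MvPolynomial.eval (fun l => (p l).coeff μ)
            (MvPolynomial.pderiv j (MvPolynomial.homogeneousComponent 2 (Γ i))) = 0) ∨
      (∃ w : Fin s → ℂ, ∀ i, ∑ j, (p j).coeff μ * MvPolynomial.eval w (MvPolynomial.pderiv j (Γ i)) = 0) := by
  intro m s a b Γ N p μ hΓ _hN hsol hμ hp hz hBz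
  classical
  -- the pole direction `z` and a coordinate `j₀` with `z j₀ ≠ 0`
  set z : Fin s → ℂ := fun j => (p j).coeff μ
  obtain ⟨j₀, hj₀⟩ : ∃ j₀, z j₀ ≠ 0 := Function.ne_iff.mp hz
  -- the chart of the pole: `p j = Λ q j`, `q j` the jet `z j + v j t^o`, `0 < o ≤ -μ`, `v j₀ = 0`
  obtain ⟨Λ, q, o, v, hΛvan, hΛμ, hpq, ho, hoμ, hjq, hvj₀, hv0⟩ :=
    exists_chart p hμ hp z (fun _ => rfl) hj₀
  -- the outputs, in the chart, have no coefficients at negative exponents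
  have hout : ∀ i, ∀ g < 0, (MvPolynomial.aeval (fun j => Λ * q j) (Γ i)).coeff g = 0 := by
    intro i g hg
    have h := hsol i
    rw [hpq] at h
    rw [h]
    exact PolarPeeling.coeff_binomial_eq_zero_of_neg N (a i) (b i) g hg
  -- `Γ_i(p)` has no coefficients below `2μ + o`, and coefficient `Σ_j v_j ∂_jB_i(z)` there
  have key := fun i => InfinityStepTwo.coeff_aeval_of_jet ho hoμ Λ hΛvan hΛμ q z v hjq (Γ i)
    (hΓ i) (hBz i)
  rcases hoμ.lt_or_eq with hlt | heq
  · -- `o < -μ` (the remainder has a pole): the direction `v ∉ ℂ z`, first disjunct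
    left
    refine ⟨v, fun c hc => ?_, fun i => ((key i).2 hlt).symm.trans (hout i _ (by omega))⟩
    have hc₀ := congr_fun hc j₀
    simp only [Pi.smul_apply, smul_eq_mul] at hc₀
    rw [hvj₀] at hc₀
    rcases mul_eq_zero.mp hc₀.symm with h | h
    · refine hv0 hlt ?_
      rw [hc, h, zero_smul]
    · exact hj₀ h
  · -- `o = -μ` (the remainder is integral, with value `v`): second disjunct with `w = v`
    right
    refine ⟨v, fun i => ?_⟩
    exact (InfinityStepTwoImproper.sum_mul_eval_pderiv_eq (Γ i) (hΓ i) z v).trans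
      ((InfinityStepTwoImproper.coeff_aeval_of_jet_top ho heq Λ hΛvan hΛμ q z v hjq (Γ i) (hΓ i)
        (hBz i)).symm.trans (hout i μ hμ))

end Summit.ValiantsHypothesis.ValiantsHypothesis.Theorems.BinomialCandidateStubs
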